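import Literature.AlgebraicGeometry.Frobenioids.KummerDualityNaturality
import Literature.AlgebraicGeometry.Frobenioids.KummerCupDualTransport
import Literature.AlgebraicGeometry.Frobenioids.KummerThetaBijective
import Literature.AlgebraicGeometry.Frobenioids.PadicKummerSettingProofs
import HarnessLib

/-!
# Frobenioids II, Theorem 2.4 (i): assembly over the cup-product duality isomorphism

Mochizuki, *The geometry of Frobenioids II*, Kyushu J. Math. **62** (2008) 401–460, §2, Theorem 2.4 (i)
pp. 19–20 [cite: MochizukiFrdII2008, Thm 2.4 (i) p.19]: "`Ψ` … induces isomorphisms … which are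
compatible with the respective Kummer and reciprocity maps"; Definition 2.2 (ii) p. 18: the duality
isomorphism `H¹(H_A, μ_N(A)) ⥲ H_A^ab ⊗ F_N(A)` "induced by the cup product" via "the well-known duality
theory of nonarchimedean local fields [NSW 7.2.6]" together with condition (c).

PROOF-ONLY assembly (abc-iut-L1-t7, typer of `PadicKummerSetting.Thm24i`) of the pieces landed for
the cell's cross-layer row L1-γ₁: abc-iut-L1-d4's `Def22Context.Iso.thm24i_of_inputs`
(`PadicKummerSettingProofs.lean`: Theorem 2.4 (i) from the three residual inputs `hp`, `hfs`, `hι`),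
abc-iut-L2-t12's CONSTRUCTED duality isomorphism `Kummer.dualityIsoOfCupProduct hθ hcup`
(`KummerDualityOfCupProduct.lean`) with its naturality `recTargetMap_dualityIsoOfCupProduct`
(`KummerDualityNaturality.lean`, = `hι`), `Kummer.thetaHom_bijective` (`KummerThetaBijective.lean`,
= `hθ` for `H_A` finite and `F_N(A) ≅ ℤ/Nℤ`) and `Kummer.cupDual_bijective_of_isCohSaturated`
(`KummerCupDualTransport.lean`, = `hcup` from condition (c) and local Tate duality for `H`):
* `Def22Context.Iso.thm24i_of_cupProduct` — **Theorem 2.4 (i) for ANY isomorphism `e` of Definition 2.2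
  contexts with the duality isomorphisms `ιᵢ := dualityIsoOfCupProduct …`, modulo EXACTLY**: `hp`
  (`p₁ = p₂`, [AbsAnab] Prop. 1.2.1 (i) — abc-iut-L1-d4's `residueChar_eq_of_iso` at the Galois
  binding), `hfs` ("`Φ₁` fieldwise saturated iff `Φ₂`", [FrdI] Cor. 4.10/4.11 — Frobenioid side), and
  the local Tate duality input `hHᵢ : Bijective (Kummer.cupDualH N Xᵢ.O Xᵢ.HA Xᵢ.qHA)` for the
  profinite `Hᵢ` (cell row W12); the saturation transfer, `F_N(A₂) ≅ ℤ/N` and the finiteness of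
  `(H₂)_{A₂}` are TRANSPORTED along `e`;
* `Def22Context.Iso.thm24i_of_cupProduct₂` — the symmetric form with both sides' data given.
Stated for ABSTRACT contexts (instantiation at `Def22Context.ofLocalField` / `Iso.ofLocalField` is by
substitution). No definitions; nothing here concerns [IUTchIII]. Universe `0`.
-/

noncomputable section

namespace Literature.AlgebraicGeometry.Frobenioids

namespace PadicKummer

namespace Def22Context.Iso

open Kummer

variable {X₁ X₂ : Def22Context} (e : Def22Context.Iso X₁ X₂) (N : ℕ) [NeZero N]

include e in
/-- `(H₂)_{A₂}` is finite if `(H₁)_{A₁}` is (`e.isoHA`). [cite: MochizukiFrdII2008, Thm 2.4 (i) p.19] -/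
theorem finite_HA [Finite X₁.HA] : Finite X₂.HA := Finite.of_equiv _ e.isoHA.toEquiv

/-- **Theorem 2.4 (i) with the cup-product duality isomorphisms, symmetric inputs**: for an
isomorphism `e` of Definition 2.2 contexts, `(N, Hᵢ)`-saturated `Aᵢ` with `(Hᵢ)_{Aᵢ}` finite,
`F_N(Aᵢ) ≅ ℤ/Nℤ`, and local Tate duality for `Hᵢ` in adjoint form (`hHᵢ`), the typed `Thm24i` holds
for the comparison data `e.thm24Data N` and the duality isomorphisms
`ιᵢ = dualityIsoOfCupProduct …` — modulo the two non-cohomological residuals `hp`, `hfs`.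
[cite: MochizukiFrdII2008, Thm 2.4 (i) p.19] -/
theorem thm24i_of_cupProduct₂ [Finite X₁.HA] [Finite X₂.HA] [LocallyCompactSpace X₁.H]
    [LocallyCompactSpace X₂.H] (p₁ p₂ : ℕ) (fs₁ fs₂ : Prop) (hp : p₁ = p₂) (hfs : fs₁ ↔ fs₂)
    (eFN₁ : FN X₁ N ≃+ ZMod N) (eFN₂ : FN X₂ N ≃+ ZMod N)
    (hc₁ : IsNHSaturated X₁ N) (hc₂ : IsNHSaturated X₂ N)
    (hH₁ : Function.Bijective (cupDualH N X₁.O X₁.HA X₁.qHA))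
    (hH₂ : Function.Bijective (cupDualH N X₂.O X₂.HA X₂.qHA)) :
    Thm24i X₁ X₂ N p₁ p₂ fs₁ fs₂ (e.thm24Data N)
      (dualityIsoOfCupProduct N X₁.O X₁.HA X₁.qHA (thetaHom_bijective N X₁.O X₁.HA X₁.qHA eFN₁)
        (cupDual_bijective_of_isCohSaturated hc₁.cohSaturated hH₁))
      (dualityIsoOfCupProduct N X₂.O X₂.HA X₂.qHA (thetaHom_bijective N X₂.O X₂.HA X₂.qHA eFN₂)
        (cupDual_bijective_of_isCohSaturated hc₂.cohSaturated hH₂)) :=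
  e.thm24i_of_inputs N p₁ p₂ fs₁ fs₂ _ _ hp hfs
    (e.recTargetMap_dualityIsoOfCupProduct N _ _ _ _)

/-- **Theorem 2.4 (i) with the cup-product duality isomorphisms**: as `thm24i_of_cupProduct₂`, with
the side-`2` data ("`Ψ` maps `(N, H₁)`-saturated objects to `(N, H₂)`-saturated objects",
`(H₂)_{A₂}` finite, `F_N(A₂) ≅ ℤ/Nℤ`) TRANSPORTED along `e` (`isNHSaturated_iff`, `F_N(A₂) ≅ F_N(A₁) ≅ ℤ/N` via `isoFN`; finiteness of `(H₂)_{A₂}` is `e.finite_HA`),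
so that the residual inputs are exactly `hp`, `hfs` and local Tate duality `hH₁`, `hH₂` for the two
profinite groups. [cite: MochizukiFrdII2008, Thm 2.4 (i) p.19] -/
theorem thm24i_of_cupProduct [Finite X₁.HA] [Finite X₂.HA] [LocallyCompactSpace X₁.H]
    [LocallyCompactSpace X₂.H]
    (p₁ p₂ : ℕ) (fs₁ fs₂ : Prop) (hp : p₁ = p₂) (hfs : fs₁ ↔ fs₂) (eFN₁ : FN X₁ N ≃+ ZMod N)
    (hc₁ : IsNHSaturated X₁ N) (hH₁ : Function.Bijective (cupDualH N X₁.O X₁.HA X₁.qHA))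
    (hH₂ : Function.Bijective (cupDualH N X₂.O X₂.HA X₂.qHA)) :
    Thm24i X₁ X₂ N p₁ p₂ fs₁ fs₂ (e.thm24Data N)
      (dualityIsoOfCupProduct N X₁.O X₁.HA X₁.qHA (thetaHom_bijective N X₁.O X₁.HA X₁.qHA eFN₁)
        (cupDual_bijective_of_isCohSaturated hc₁.cohSaturated hH₁))
      (dualityIsoOfCupProduct N X₂.O X₂.HA X₂.qHA
        (thetaHom_bijective N X₂.O X₂.HA X₂.qHA ((e.isoFN N).symm.trans eFN₁))
        (cupDual_bijective_of_isCohSaturated ((e.isNHSaturated_iff N).mp hc₁).cohSaturated hH₂)) :=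
  e.thm24i_of_cupProduct₂ N p₁ p₂ fs₁ fs₂ hp hfs eFN₁ ((e.isoFN N).symm.trans eFN₁) hc₁
    ((e.isNHSaturated_iff N).mp hc₁) hH₁ hH₂

end Def22Context.Iso

end PadicKummer

end Literature.AlgebraicGeometry.Frobenioids

end
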